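import Summits.KontsevichZagierPeriods.KontsevichZagierPeriods.Theorems.SoloBlindPiDiscReps
import Summits.KontsevichZagierPeriods.KontsevichZagierPeriods.Theorems.SoloBlindZetaTwoSquare
import HarnessLib

/-!
# Kontsevich–Zagier's representations of `π` (eq. (1)), inside the rules, II: the moves

Kontsevich–Zagier open *Periods* (2001, §1.1, eq. (1)) with
`π = ∬_{x²+y²≤1} dx dy = 2∫_{-1}^{1} √(1-x²) dx = ∫_{-1}^{1} dx/√(1-x²) = ∫_{-∞}^{∞} dx/(1+x²)`.
The first and the last member are representations with RATIONAL data in the sense of their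
§1.2, and Conjecture 1 predicts that one passes from one to the other by the three rules.  We do
it, with `ℚ`-rational moves only and without rule (3):

* `exists_polarChart`: the rational polar chart `Ψ(x,y) = (y/x, x²+y²)` maps the right
  half-disc `{x>0, x²+y²≤1}` injectively ONTO the strip `ℝ × (0,1]`, with
  `|det DΨ| = 2(x²+y²)/x² = 2(1+u²)`; so `[half-disc, 1] ≡ [ℝ×(0,1], 1/(2(1+u²))]`, which has the
  data of the Fubini product `(C/2) × I = [ℝ, 1/(2(1+u²))] × [(0,1], 1]`
  (`equivalent_halfDiscPos_prod`);
* the left half-disc is carried onto the right one by the reflection `(x,y) ↦ (-x,y)`, and the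
  closed disc is the union of the two half-discs and the null diameter `{x=0}` (two additivity
  moves and one null-set move);
* hence `disc_sub_two_prod : [D̄,1] - 2·[(C/2) × I] ∈ relations`; the class of the disc lies in
  the tame `π`-sector `M_π` (`of_discRep_mem_piSector`); `value [D̄,1] = π` move-theoretically
  (`discRep_value_eq_cauchyLine_value`: the area of the unit disc, with no planar integration); and
  `kz_pi_disc : Equivalent discRep cauchyLine` — the outer members of eq. (1) are KZ-equivalent —
  by the unconditional conjecture on `M_π` (`kz_piSector`), together with its pinned form and
  the cross-dimensional instance `[D̄]·[D̄] ≡ 6·[Z]` (`Z` = Kontsevich–Zagier's `ζ(2)` integral).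

References: M. Kontsevich, D. Zagier, *Periods* (2001), §1.1 eq. (1), §1.2 (rules, Conjecture 1).
-/

noncomputable section

namespace Summit.KontsevichZagierPeriods.KontsevichZagierPeriods.Theorems

open Set MeasureTheory
open Literature.ModelTheory.ExponentialFields (IsSemialgebraic)
open MvPolynomial (aeval X)
open Literature.NumberTheory.Transcendental
open Literature.NumberTheory.Transcendental.KZ

namespace SoloBlind

/-! ## The rational polar chart -/

/-- **The rational polar chart** `Ψ(x,y) = (y/x, x²+y²)` on the right half-disc `{x>0, x²+y²≤1}`:
semialgebraic over `ℚ`, differentiable with `|det Ψ'| = 2(x²+y²)/x² = 2(1+u²)` (`u = y/x`),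
injective, with image the strip `ℝ × (0,1]`. -/
theorem exists_polarChart :
    ∃ (Ψ : (Fin 2 → ℝ) → (Fin 2 → ℝ)) (Ψ' : (Fin 2 → ℝ) → (Fin 2 → ℝ) →L[ℝ] (Fin 2 → ℝ)),
      (∀ z, Ψ z 0 = z 1 / z 0) ∧ (∀ z, Ψ z 1 = z 0 ^ 2 + z 1 ^ 2) ∧
      IsSemialgebraicMapOn ℚ kzHalfDiscPos Ψ ∧ (∀ z ∈ kzHalfDiscPos, HasFDerivAt Ψ (Ψ' z) z) ∧
      InjOn Ψ kzHalfDiscPos ∧ Ψ '' kzHalfDiscPos = kzStrip ∧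
      (∀ z ∈ kzHalfDiscPos, |(Ψ' z).det| = 2 * (z 0 ^ 2 + z 1 ^ 2) / z 0 ^ 2) := by
  set Ψ : (Fin 2 → ℝ) → (Fin 2 → ℝ) := fun z => ![z 1 / z 0, z 0 ^ 2 + z 1 ^ 2] with hΨ
  set Ψ' : (Fin 2 → ℝ) → (Fin 2 → ℝ) →L[ℝ] (Fin 2 → ℝ) :=
    fun z => LinearMap.toContinuousLinearMap (Matrix.toLin'
      !![-(z 1) / z 0 ^ 2, 1 / z 0; 2 * z 0, 2 * z 1]) with hΨ'
  have hΨ0 : ∀ z, Ψ z 0 = z 1 / z 0 := fun z => rfl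
  have hΨ1 : ∀ z, Ψ z 1 = z 0 ^ 2 + z 1 ^ 2 := fun z => rfl
  have hΨ'0 : ∀ z v : Fin 2 → ℝ, Ψ' z v 0 = -(z 1) / z 0 ^ 2 * v 0 + 1 / z 0 * v 1 := by
    intro z v
    change Matrix.toLin' !![-(z 1) / z 0 ^ 2, 1 / z 0; 2 * z 0, 2 * z 1] v 0 = _
    rw [Matrix.toLin'_apply]
    simp [Matrix.mulVec, dotProduct, Fin.sum_univ_two]
  have hΨ'1 : ∀ z v : Fin 2 → ℝ, Ψ' z v 1 = 2 * z 0 * v 0 + 2 * z 1 * v 1 := by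
    intro z v
    change Matrix.toLin' !![-(z 1) / z 0 ^ 2, 1 / z 0; 2 * z 0, 2 * z 1] v 1 = _
    rw [Matrix.toLin'_apply]
    simp [Matrix.mulVec, dotProduct, Fin.sum_univ_two]
  have hdet : ∀ z : Fin 2 → ℝ, z 0 ≠ 0 →
      (Ψ' z).det = -(2 * (z 0 ^ 2 + z 1 ^ 2) / z 0 ^ 2) := by
    intro z hz0
    change LinearMap.det (Matrix.toLin' !![-(z 1) / z 0 ^ 2, 1 / z 0; 2 * z 0, 2 * z 1]) = _
    rw [LinearMap.det_toLin', Matrix.det_fin_two]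
    simp only [Matrix.of_apply, Matrix.cons_val', Matrix.cons_val_zero, Matrix.cons_val_one,
      Matrix.cons_val_fin_one, Matrix.empty_val']
    field_simp
    ring
  have hderiv : ∀ z : Fin 2 → ℝ, 0 < z 0 → HasFDerivAt Ψ (Ψ' z) z := by
    intro z hz0
    have hz0' : z 0 ≠ 0 := hz0.ne'
    have h0 : HasFDerivAt (fun y : Fin 2 → ℝ => y 0)
        (ContinuousLinearMap.proj (R := ℝ) (φ := fun _ : Fin 2 => ℝ) 0) z := hasFDerivAt_apply 0 z
    have h1 : HasFDerivAt (fun y : Fin 2 → ℝ => y 1)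
        (ContinuousLinearMap.proj (R := ℝ) (φ := fun _ : Fin 2 => ℝ) 1) z := hasFDerivAt_apply 1 z
    have hinv0 : HasFDerivAt (fun y : Fin 2 → ℝ => (y 0)⁻¹)
        ((ContinuousLinearMap.toSpanSingleton ℝ (-(z 0 ^ 2)⁻¹)).comp
          (ContinuousLinearMap.proj (R := ℝ) (φ := fun _ : Fin 2 => ℝ) 0)) z :=
      (hasFDerivAt_inv hz0').comp z h0
    rw [hasFDerivAt_pi']
    refine Fin.forall_fin_two.mpr ⟨?_, ?_⟩
    · have hf : (fun y : Fin 2 → ℝ => Ψ y 0) = fun y => y 1 * (y 0)⁻¹ :=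
        funext fun y => by rw [hΨ0, div_eq_mul_inv]
      rw [hf]
      refine (h1.mul hinv0).congr_fderiv (ContinuousLinearMap.ext fun v => ?_)
      simp [hΨ'0]
      ring
    · have hf : (fun y : Fin 2 → ℝ => Ψ y 1) = fun y => y 0 * y 0 + y 1 * y 1 :=
        funext fun y => by rw [hΨ1, pow_two, pow_two]
      rw [hf]
      refine ((h0.mul h0).add (h1.mul h1)).congr_fderiv (ContinuousLinearMap.ext fun v => ?_)
      simp [hΨ'1]
      ring
  refine ⟨Ψ, Ψ', hΨ0, hΨ1, ?_, fun z hz => hderiv z hz.1, ?_, ?_, fun z hz => ?_⟩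
  · refine IsSemialgebraicMapOn.of_forall isSemialgebraic_kzHalfDiscPos
      (Fin.forall_fin_two.mpr ⟨?_, ?_⟩)
    · refine (isSemialgebraicFunOn_aeval_div_aeval isSemialgebraic_kzHalfDiscPos (X 1) (X 0)
        fun x hx => ?_).congr fun x _ => by simp [hΨ0]
      rw [mem_kzHalfDiscPos] at hx
      simpa using hx.1.ne'
    · exact (isSemialgebraicFunOn_aeval isSemialgebraic_kzHalfDiscPos
        (X 0 ^ 2 + X 1 ^ 2 : MvPolynomial (Fin 2) ℚ)).congr fun x _ => by simp [hΨ1]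
  · intro x hx y hy hxy
    have e0 := congrFun hxy 0
    have e1 := congrFun hxy 1
    simp only [hΨ0, hΨ1] at e0 e1
    rw [mem_kzHalfDiscPos] at hx hy
    rw [div_eq_div_iff hx.1.ne' hy.1.ne'] at e0
    -- `e0 : x 1 * y 0 = y 1 * x 0`, `e1 : x 0 ^ 2 + x 1 ^ 2 = y 0 ^ 2 + y 1 ^ 2`
    have hsq : (x 1 * y 0) ^ 2 = (y 1 * x 0) ^ 2 := by rw [e0]
    have h3 : (x 0 ^ 2 - y 0 ^ 2) * (y 0 ^ 2 + y 1 ^ 2) = 0 := by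
      linear_combination (y 0 ^ 2) * e1 - hsq
    have hne : y 0 ^ 2 + y 1 ^ 2 ≠ 0 := by
      have : 0 < y 0 ^ 2 + y 1 ^ 2 := by nlinarith [hy.1, sq_nonneg (y 1)]
      exact this.ne'
    have h4 : x 0 ^ 2 - y 0 ^ 2 = 0 := by
      rcases mul_eq_zero.mp h3 with h | h
      · exact h
      · exact absurd h hne
    have h5 : (x 0 - y 0) * (x 0 + y 0) = 0 := by linear_combination h4
    have h00 : x 0 = y 0 := by
      rcases mul_eq_zero.mp h5 with h | h
      · linarith
      · linarith [hx.1, hy.1]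
    have h11 : x 1 = y 1 := by
      rw [h00] at e0
      exact mul_right_cancel₀ hy.1.ne' e0
    funext i
    fin_cases i
    · exact h00
    · exact h11
  · ext w
    constructor
    · rintro ⟨z, hz, rfl⟩
      rw [mem_kzHalfDiscPos] at hz
      rw [mem_kzStrip]
      simp only [hΨ1]
      exact ⟨by nlinarith [hz.1, sq_nonneg (z 1)], hz.2⟩
    · intro hw
      rw [mem_kzStrip] at hw
      obtain ⟨hw1, hw1'⟩ := hw
      have hq : (0:ℝ) < 1 + w 0 ^ 2 := by positivity
      set s : ℝ := Real.sqrt (w 1 / (1 + w 0 ^ 2)) with hs_def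
      have hs : 0 < s := Real.sqrt_pos.mpr (div_pos hw1 hq)
      have hs2 : s ^ 2 = w 1 / (1 + w 0 ^ 2) := Real.sq_sqrt (div_pos hw1 hq).le
      have hsum : s ^ 2 + (w 0 * s) ^ 2 = w 1 := by
        have h' : s ^ 2 + (w 0 * s) ^ 2 = s ^ 2 * (1 + w 0 ^ 2) := by ring
        rw [h', hs2, div_mul_cancel₀ _ hq.ne']
      refine ⟨![s, w 0 * s], ?_, ?_⟩
      · rw [mem_kzHalfDiscPos]
        refine ⟨hs, ?_⟩
        change s ^ 2 + (w 0 * s) ^ 2 ≤ 1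
        rw [hsum]
        exact hw1'
      · funext i
        fin_cases i
        · change w 0 * s / s = w 0
          field_simp
        · change s ^ 2 + (w 0 * s) ^ 2 = w 1
          exact hsum
  · rw [mem_kzHalfDiscPos] at hz
    rw [hdet z hz.1.ne', abs_neg]
    exact abs_of_pos (div_pos (by nlinarith [hz.1, sq_nonneg (z 1)]) (pow_pos hz.1 2))

/-! ## The moves -/

/-- Move (additivity): `D̄ = {x>0,…} ∪ {x≤0,…}`. -/
theorem disc_sub_pos_sub_nonpos :
    of discRep - of halfDiscPosRep - of halfDiscNonposRep ∈ relations := by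
  refine domainAddRel_subset_relations ⟨2, discRep, halfDiscPosRep, halfDiscNonposRep, ?_,
    ?_, fun _ _ => rfl, fun _ _ => rfl, rfl⟩
  · change kzDisc = kzHalfDiscPos ∪ kzHalfDiscNonpos
    ext z
    simp only [mem_union, mem_kzDisc, mem_kzHalfDiscPos, mem_kzHalfDiscNonpos]
    constructor
    · intro h
      rcases lt_or_ge 0 (z 0) with h0 | h0
      · exact Or.inl ⟨h0, h⟩
      · exact Or.inr ⟨h0, h⟩
    · rintro (⟨_, h⟩ | ⟨_, h⟩)
      · exact h
      · exact h
  · have h : (halfDiscPosRep.domain ∩ halfDiscNonposRep.domain : Set (Fin 2 → ℝ)) = ∅ := by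
      change kzHalfDiscPos ∩ kzHalfDiscNonpos = ∅
      ext z
      simp only [mem_inter_iff, mem_kzHalfDiscPos, mem_kzHalfDiscNonpos, mem_empty_iff_false,
        iff_false]
      rintro ⟨⟨h1, -⟩, h2, -⟩
      exact absurd h2 (not_le.mpr h1)
    rw [h, measure_empty]

/-- Move (additivity): `{x≤0,…} = {x<0,…} ∪ {x=0,…}`. -/
theorem nonpos_sub_neg_sub_axis :
    of halfDiscNonposRep - of halfDiscNegRep - of discAxisRep ∈ relations := by
  refine domainAddRel_subset_relations ⟨2, halfDiscNonposRep, halfDiscNegRep, discAxisRep, ?_,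
    measure_mono_null inter_subset_right volume_kzDiscAxis, fun _ _ => rfl, fun _ _ => rfl, rfl⟩
  change kzHalfDiscNonpos = kzHalfDiscNeg ∪ kzDiscAxis
  ext z
  simp only [mem_union, mem_kzHalfDiscNonpos, mem_kzHalfDiscNeg, mem_kzDiscAxis]
  constructor
  · rintro ⟨h0, h⟩
    rcases h0.lt_or_eq with h0 | h0
    · exact Or.inl ⟨h0, h⟩
    · exact Or.inr ⟨h0, h⟩
  · rintro (⟨h0, h⟩ | ⟨h0, h⟩)
    · exact ⟨h0.le, h⟩
    · exact ⟨h0.le, h⟩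

/-- Move (null set): the diameter carries no period. -/
theorem axis_mem_relations : of discAxisRep ∈ relations :=
  levelRel_le_relations (of_mem_levelRel_of_volume_eq_zero discAxisRep volume_kzDiscAxis)

/-- Move (change of variables): the reflection carries the left half-disc onto the right one. -/
theorem equivalent_neg_pos : Equivalent halfDiscNegRep halfDiscPosRep := by
  obtain ⟨Φ, Φ', hΦ0, hΦ1, hsa, hderiv, hinj, himage, hdet⟩ := exists_reflectionChart
  exact equivalent_of_chart hsa hderiv hinj himage hdet (f := fun _ : Fin 2 → ℝ => (1 : ℝ))
    (g := fun _ : Fin 2 → ℝ => (1 : ℝ)) (fun _ _ => by rw [mul_one]) rfl (fun _ _ => rfl) rfl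
    (fun _ _ => rfl)

/-- **Move (change of variables): the rational polar chart** carries `[{x>0, x²+y²≤1}, 1]` onto
`[ℝ×(0,1], 1/(2(1+u²))] = (C/2) × I`: `1 = (1/(2(1+u²)))·|J|` with `u = y/x`,
`|J| = 2(x²+y²)/x²`. -/
theorem equivalent_halfDiscPos_prod :
    Equivalent halfDiscPosRep (halfCauchyLine.prod unitIoc) := by
  obtain ⟨Ψ, Ψ', hΨ0, hΨ1, hsa, hderiv, hinj, himage, hdet⟩ := exists_polarChart
  refine equivalent_of_chart hsa hderiv hinj himage hdet (f := fun _ : Fin 2 → ℝ => (1 : ℝ))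
    (g := fun w : Fin 2 → ℝ => 1 / (2 * (1 + w 0 ^ 2))) (fun z hz => ?_) rfl (fun _ _ => rfl)
    prod_halfCauchy_unitIoc_domain (fun w _ => prod_halfCauchy_unitIoc_integrand w)
  simp only [hΨ0]
  rw [mem_kzHalfDiscPos] at hz
  have h0 : z 0 ≠ 0 := hz.1.ne'
  have h2 : z 0 ^ 2 + z 1 ^ 2 ≠ 0 := by
    have : 0 < z 0 ^ 2 + z 1 ^ 2 := by nlinarith [hz.1, sq_nonneg (z 1)]
    exact this.ne'
  field_simp

/-- **`[D̄, 1] ≡ 2·(C/2) × I`**: the disc is congruent, modulo finitely many additivity and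
rational change-of-variables moves, to two copies of the product `[ℝ, 1/(2(1+u²))] × [(0,1], 1]`. -/
theorem disc_sub_two_prod :
    of discRep - 2 • of (halfCauchyLine.prod unitIoc) ∈ relations := by
  have h := add_mem (add_mem (add_mem (add_mem (add_mem disc_sub_pos_sub_nonpos
    nonpos_sub_neg_sub_axis) axis_mem_relations) equivalent_neg_pos)
    equivalent_halfDiscPos_prod) equivalent_halfDiscPos_prod
  convert h using 1
  abel

/-! ## Consequences -/

/-- In `Q`, `[D̄] = 2·[C/2]·[I]`. -/
theorem mkQ_discRep :
    mkQ (of discRep) = 2 • (mkQ (of halfCauchyLine) * mkQ (of unitIoc)) := by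
  rw [← mkQ_mul, of_mul_of, ← map_nsmul, mkQ_eq_mkQ_iff]
  exact disc_sub_two_prod

/-- **The disc lies in the tame `π`-sector `M_π`.** -/
theorem of_discRep_mem_piSector : of discRep ∈ piSector := by
  have h1 : of halfCauchyLine ∈ piSector :=
    lineRing_pi_le_piSector (NonUnitalSubring.subset_closure of_halfCauchyLine_mem_lineGens)
  have h2 : of unitIoc ∈ piSector :=
    lineRing_pi_le_piSector (NonUnitalSubring.subset_closure of_unitIoc_mem_lineGens)
  rw [mem_piSector] at h1 h2 ⊢
  rw [mkQ_discRep]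
  exact nsmul_mem (mul_mem h1 h2) 2

/-- `C` lies in `M_π`. -/
theorem of_cauchyLine_mem_piSector : of cauchyLine ∈ piSector :=
  lineRing_pi_le_piSector (NonUnitalSubring.subset_closure of_cauchyLine_mem_lineGens)

/-- **The disc and the Cauchy line have the same value** (the area of the unit disc is `π`,
move-theoretically): read off from `disc_sub_two_prod`, the soundness of the moves,
`∫ dx/(2(1+x²)) = π/2` and `∫_{(0,1]} 1 = 1`; combine with `cauchyLine_value` for `= π`. -/
theorem discRep_value_eq_cauchyLine_value : discRep.value = cauchyLine.value := by
  rw [cauchyLine_value]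
  have h' := relations_le_ker_eval_holds disc_sub_two_prod
  rw [AddMonoidHom.mem_ker, map_sub, map_nsmul, eval_of, eval_of, IntegralRep.value_prod,
    halfCauchyLine_value, unitIoc_value] at h'
  simp only [nsmul_eq_mul, Nat.cast_ofNat] at h'
  linear_combination h'

/-- **Kontsevich–Zagier's eq. (1), inside the rules.**  The first and the last representation of
`π` in *Periods*, eq. (1) — the area `∬_{x²+y²≤1} dx dy` and the integral `∫_{-∞}^{∞} dx/(1+x²)` —
are equivalent under finitely many instances of the rules (1) (additivity) and (2) (change of
variables), all with `ℚ`-rational data. -/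
theorem kz_pi_disc : Equivalent discRep cauchyLine :=
  kz_piSector _ _ of_discRep_mem_piSector of_cauchyLine_mem_piSector
    discRep_value_eq_cauchyLine_value

/-- Pinned form of `kz_pi_disc`: any representation with domain `{x²+y²≤1}` and integrand `1` is
equivalent to any representation with domain `ℝ¹` and integrand `1/(1+x²)`. -/
theorem kz_pi_disc_pinned (r : IntegralRep 2) (r' : IntegralRep 1) (hrd : r.domain = kzDisc)
    (hri : ∀ z ∈ r.domain, r.integrand z = 1) (hr'd : r'.domain = line univ)
    (hr'i : ∀ x ∈ r'.domain, r'.integrand x = 1 / (1 + x 0 ^ 2)) : Equivalent r r' := by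
  have h1 : of r - of discRep ∈ relations :=
    of_sub_of_mem_relations_of_eqOn hrd.symm fun z hz => hri z hz
  have h2 : of cauchyLine - of r' ∈ relations :=
    of_sub_of_mem_relations_of_eqOn hr'd fun x hx => (hr'i x (hr'd ▸ hx)).symm
  have h := add_mem (add_mem h1 kz_pi_disc) h2
  unfold Equivalent at h ⊢
  convert h using 1
  abel

/-- The disc is KZ-equivalent to every representation of `π` in the rank-one ring `B(π)` (e.g.
`4∫₀¹ dx/(1+x²)`, `2∫_{-1}^{1} dx/(1+x²)`, `[(0,1), 2] × [ℝ, 1/(2(1+x²))]`, …). -/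
theorem kz_pi_disc_of_mem_lineRing {m : ℕ} (r' : IntegralRep m) (hr' : of r' ∈ lineRing Real.pi)
    (hv : r'.value = Real.pi) : Equivalent discRep r' :=
  kz_piSector _ _ of_discRep_mem_piSector (lineRing_pi_le_piSector hr')
    (by rw [discRep_value_eq_cauchyLine_value, cauchyLine_value, hv])

/-- Across dimensions and degrees: `[D̄]·[D̄]` (a four-dimensional representation of `π²`) and
`6·[Z]` (Kontsevich–Zagier's `ζ(2)` integral) are KZ-equivalent. -/
theorem kz_disc_sq_six_zetaTwo :
    of (discRep.prod discRep) - 6 • of zetaTwoRep ∈ relations := by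
  refine piSector_kernel (sub_mem ?_ (nsmul_mem of_zetaTwoRep_mem_piSector 6)) ?_
  · rw [← of_mul_of]
    exact mul_mem of_discRep_mem_piSector of_discRep_mem_piSector
  · rw [map_sub, map_nsmul, eval_of, eval_of, IntegralRep.value_prod,
      discRep_value_eq_cauchyLine_value, cauchyLine_value, zetaTwoRep_value]
    simp only [nsmul_eq_mul, Nat.cast_ofNat]
    ring

end SoloBlind

end Summit.KontsevichZagierPeriods.KontsevichZagierPeriods.Theorems
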